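import Mathlib
import Literature.NumberTheory.LFunctions.MultiplicativeAutomatic

/-!
# Block-additive digital functions are 2-automatic (kernel formulation)

A BLOCK-ADDITIVE digital function of window length `L` is `c(N) = Σ_i Q(x_i, …, x_{i+L-1}) ∈ 𝔽₂`,
where `x_t = N.testBit t` are the binary digits of `N` and `Q(0, …, 0) = 0` (so only finitely many
windows contribute); the Rudin–Shapiro phase `Σ_i x_i x_{i+1}` is the case `L = 2`. For every
`Φ : 𝔽₂ → ℂ` the sequence `N ↦ Φ (c N)` is 2-automatic in the tree's kernel sense
(`Literature.NumberTheory.LFunctions.IsAutomaticSeq 2`, finite 2-kernel): for `i ≥ 1`, `r < 2^i`,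
the digits of `2^i n + r` are those of `r` (positions `< i`) followed by those of `n`, so
`c(2^i n + r) = S_{i,r}(n mod 2^{L-1}) + c(n)`, where `S_{i,r}(u)` collects the windows starting
below position `i` (they only see the lowest `L - 1` digits of `n`). Hence every kernel element is
`n ↦ Φ (τ(n mod 2^{L-1}) + c n)` for some `τ : Fin 2^{L-1} → 𝔽₂`, a finite family.
Helper for line Sketch of crux stmt-QuantumAdvantage-1392 (automatic digital phases are
orthogonal to the Liouville function modulo Müllner 2017).
-/

set_option linter.dupNamespace false -- D-0017: single-problem summit ⇒ QuantumAdvantage.QuantumAdvantage by design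
set_option autoImplicit false

namespace Summit.QuantumAdvantage.QuantumAdvantage.Theorems.MobiusLadder

namespace BlockAdditive

/-- Size of a kernel index: if `r < 2^i` then `2^i n + r < 2^(i+n)`. [folklore] -/
theorem two_pow_mul_add_lt {i r : ℕ} (hr : r < 2 ^ i) (n : ℕ) :
    2 ^ i * n + r < 2 ^ (i + n) := by
  have hn : n + 1 ≤ 2 ^ n := Nat.lt_two_pow_self
  rw [pow_add]
  calc 2 ^ i * n + r < 2 ^ i * n + 2 ^ i := by omega
    _ = 2 ^ i * (n + 1) := by ring
    _ ≤ 2 ^ i * 2 ^ n := Nat.mul_le_mul_left _ hn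

/-- **Kernel recursion for block-additive functions.** If `c` is block-additive with window map
`Q` (in the sense `c N = Σ_{t<M} Q(window of N at t)` whenever `N < 2^M`), then for `r < 2^i`
`c (2^i n + r) = S + c n`, where `S` is the sum over the window positions `t < i` of `Q` applied
to the window of `2^i n + r` at `t`, which reads the digits of `r` below position `i` and the
digits of `n mod 2^(L-1)` from position `i` on. [folklore] -/
theorem kernel_decomp (L : ℕ) (Q : (Fin L → Bool) → ZMod 2) (c : ℕ → ZMod 2)
    (hc : ∀ N M : ℕ, N < 2 ^ M →
      c N = ∑ i ∈ Finset.range M, Q (fun j : Fin L => N.testBit (i + j)))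
    {i r : ℕ} (hr : r < 2 ^ i) (n : ℕ) :
    c (2 ^ i * n + r) =
      (∑ t ∈ Finset.range i, Q (fun j : Fin L =>
        if t + (j : ℕ) < i then r.testBit (t + j) else (n % 2 ^ (L - 1)).testBit (t + j - i))) +
        c n := by
  rw [hc _ _ (two_pow_mul_add_lt hr n), hc n n Nat.lt_two_pow_self, Finset.sum_range_add]
  congr 1
  · refine Finset.sum_congr rfl fun t ht => ?_
    rw [Finset.mem_range] at ht
    refine congrArg Q (funext fun j => ?_)
    have hj : (j : ℕ) < L := j.is_lt
    rw [Nat.testBit_two_pow_mul_add _ hr]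
    by_cases h : t + (j : ℕ) < i
    · rw [if_pos h, if_pos h]
    · have hlt : t + (j : ℕ) - i < L - 1 := by omega
      rw [if_neg h, if_neg h, Nat.testBit_mod_two_pow, decide_eq_true hlt, Bool.true_and]
  · refine Finset.sum_congr rfl fun t _ => ?_
    refine congrArg Q (funext fun j => ?_)
    rw [Nat.testBit_two_pow_mul_add _ hr, if_neg (by omega)]
    congr 1
    omega

end BlockAdditive

/-- **Block-additive digital functions are 2-automatic.** Let `Q : (Fin L → Bool) → 𝔽₂` with
`Q(0,…,0) = 0` and let `c : ℕ → 𝔽₂` satisfy `c N = Σ_{i<M} Q (j ↦ x_{i+j}(N))` whenever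
`N < 2^M` (`x_t(N) = N.testBit t`; e.g. the Rudin–Shapiro phase `Σ x_i x_{i+1}`). Then for every
`Φ : 𝔽₂ → ℂ` the sequence `N ↦ Φ (c N)` has finite 2-kernel: each kernel element
`n ↦ Φ (c (2^i n + r))` equals `n ↦ Φ (τ (n mod 2^(L-1)) + c n)` for some
`τ : Fin 2^(L-1) → 𝔽₂` (`BlockAdditive.kernel_decomp`), and there are finitely many such `τ`.
[folklore] -/
theorem isAutomaticSeq_of_blockAdditive :
    ∀ (L : ℕ) (Q : (Fin L → Bool) → ZMod 2), Q (fun _ => false) = 0 → ∀ c : ℕ → ZMod 2, (∀ N M : ℕ, N < 2 ^ M → c N = ∑ i ∈ Finset.range M, Q (fun j : Fin L => N.testBit (i + j))) → ∀ Φ : ZMod 2 → ℂ, Literature.NumberTheory.LFunctions.IsAutomaticSeq 2 (fun N => Φ (c N)) := by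
  intro L Q _ c hc Φ
  refine (Set.finite_range (fun τ : Fin (2 ^ (L - 1)) → ZMod 2 => fun n : ℕ =>
    Φ (τ ⟨n % 2 ^ (L - 1), Nat.mod_lt _ (Nat.two_pow_pos _)⟩ + c n))).subset ?_
  rintro g ⟨i, -, r, hr, rfl⟩
  refine ⟨fun u => ∑ t ∈ Finset.range i, Q (fun j : Fin L =>
    if t + (j : ℕ) < i then r.testBit (t + j) else (u : ℕ).testBit (t + j - i)), ?_⟩
  funext n
  exact congrArg Φ (BlockAdditive.kernel_decomp L Q c hc hr n).symm

end Summit.QuantumAdvantage.QuantumAdvantage.Theorems.MobiusLadder
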